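/- Free-seat work of EXTRA WIDTH SEAT `ym-line-cbag-p1-w5` (prover-ym-line-cbag-p1-w5-g3-0), route `EguchiKawaiDirectionLadder`
(ideator ym-idea-2, LINE 8), crux `TripleSmallBallMargin` (stmt-QuantumFields-27724), v7 architecture stub S10-B «transported
Fin n_b ≃ β»: HAAR TRANSPORT ALONG RE-INDEXING.  The (rank-robust) rigidity / pair small-ball bounds (S2, S4, S7, S8) are stated
for `UN n = U(Fin n)`, while the one-level decoupling inequality (`haar_prod_le_prod_robustPair_mul`, S9) consumes them on the BLOCK
groups `U({i : Fin N // ℓ i = c})`; re-indexing along any `e : β ≃ γ` is a continuous ⋆-isomorphism `U(β) ≃ U(γ)` carrying Haar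
probability to Haar probability, so every Haar / Haar-pair / Haar-power event pulls back with EQUAL measure (no measurability side
condition).  ROUTE-INDEPENDENT (no Theses import).  Nothing here bears on the Yang–Mills mass gap. -/
import Literature.Barriers.QuantumFields.EguchiKawaiBreakdown
import Mathlib.MeasureTheory.Measure.Haar.Basic
import Mathlib.LinearAlgebra.Matrix.Rank
import Mathlib.LinearAlgebra.Matrix.Reindex
import HarnessLib

/-!
# Route `EguchiKawaiDirectionLadder`: Haar transport along re-indexing of unitary groups

For finite index types `β, γ` and an equivalence `e : β ≃ γ`:

* `reindexStarMulEquiv e : Matrix β β ℂ ≃⋆* Matrix γ γ ℂ` (`M ↦ Matrix.reindex e e M`) and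
  `reindexUnitary e : U(β) ≃⋆* U(γ)` (`Unitary.mapEquiv` of it; `coe_reindexUnitary`), continuous in both directions,
  packaged as a measurable equivalence `reindexUnitaryMeasurableEquiv e`;
* `eq_haarProbability_of_isMulLeftInvariant` — a left-invariant probability measure on a compact second-countable group IS the
  normalised Haar measure (Mathlib's `haarMeasure_unique`); hence
  `map_haarProbability_reindexUnitary : (haarProbability U(β)).map (reindexUnitary e) = haarProbability U(γ)`;
* measure-preserving maps and EQUALITY OF MEASURES OF PULLED-BACK EVENTS, for arbitrary sets: one factor
  (`haarProbability_preimage_reindexUnitary`, `haarProbability_setOf_reindex`), Haar pairs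
  (`haarPair_preimage_reindexUnitary`, `haarPair_setOf_reindex`) and `Fin d`-powers, landing in `ekHaar d n` when `γ = Fin n`
  (`haarPi_preimage_reindexUnitary`, `haarPi_setOf_reindex_eq_ekHaar`);
* the re-indexing algebra needed to recognise pulled-back events (`reindex` of products / differences / diagonals, invariance of
  entrywise sums `Σ_{ij} F i j (M i j)`, of Frobenius sums and of the rank), and two worked instances in the exact shape of the
  S9 slot `h_Ψ` and of the rank-robust one-link rigidity event:
  `haarPair_rankRobustCommutator_reindex` — `Haar_β²{∃ L, rank L ≤ r ∧ ‖P₁P₂ − P₂P₁ − L‖_F² ≤ σ} = Haar_γ²{same}`,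
  `haarProbability_rankRobustLink_reindex` — `Haar_β{W | ∃ R, rank R ≤ r ∧ ‖DW − WD − R‖_F² ≤ s} = Haar_γ{… reindex D …}`.

HONEST FRAMING: pure transport/bookkeeping (folklore: uniqueness of Haar measure); no small-ball estimate is proved here.  The
route bears on the barrier-ledger fact `EguchiKawaiBreakdown` only; the Yang–Mills mass gap is NOT touched.
-/

set_option autoImplicit false

noncomputable section

open MeasureTheory
open scoped Matrix ENNReal
open Literature.Barriers.QuantumFields
open Literature.MathematicalPhysics.QuantumFieldTheory (haarProbability)

namespace Summit.QuantumFields.YangMills.Theorems.EguchiKawaiDirectionLadder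

namespace HaarReindex

/-! ### §0 Re-indexing algebra (recognising pulled-back events) -/

section Algebra

variable {β γ : Type*}

/-- `reindex e e (M N) = reindex e e M · reindex e e N`. -/
theorem reindex_mul [Fintype β] [Fintype γ] (e : β ≃ γ) (M N : Matrix β β ℂ) :
    Matrix.reindex e e (M * N) = Matrix.reindex e e M * Matrix.reindex e e N :=
  (Matrix.submatrix_mul_equiv M N e.symm e.symm e.symm).symm

/-- `reindex e e (M − N) = reindex e e M − reindex e e N`. -/
theorem reindex_sub (e : β ≃ γ) (M N : Matrix β β ℂ) :
    Matrix.reindex e e (M - N) = Matrix.reindex e e M - Matrix.reindex e e N := rfl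

/-- `reindex e e 1 = 1`. -/
theorem reindex_one [DecidableEq β] [DecidableEq γ] (e : β ≃ γ) : Matrix.reindex e e (1 : Matrix β β ℂ) = 1 :=
  Matrix.submatrix_one_equiv e.symm

/-- `reindex e e (diagonal d) = diagonal (d ∘ e.symm)`. -/
theorem reindex_diagonal [DecidableEq β] [DecidableEq γ] (e : β ≃ γ) (d : β → ℂ) :
    Matrix.reindex e e (Matrix.diagonal d) = Matrix.diagonal (d ∘ e.symm) :=
  Matrix.submatrix_diagonal_equiv d e.symm

/-- `reindex e e (reindex e.symm e.symm M) = M`. -/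
theorem reindex_reindex_symm (e : β ≃ γ) (M : Matrix γ γ ℂ) :
    Matrix.reindex e e (Matrix.reindex e.symm e.symm M) = M := by
  ext i j; simp

/-- **Entrywise sums are invariant**: `Σ_{i,j} F i j ((reindex e e M) i j) = Σ_{i,j} F (e i) (e j) (M i j)` for any summand
depending on the position — e.g. weighted Frobenius sums `Σ w_{ij} |M_{ij}|²` with `w` transported along `e`. -/
theorem sum_sum_reindex_apply [Fintype β] [Fintype γ] {α : Type*} [AddCommMonoid α] (e : β ≃ γ) (M : Matrix β β ℂ)
    (F : γ → γ → ℂ → α) :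
    ∑ i, ∑ j, F i j (Matrix.reindex e e M i j) = ∑ i, ∑ j, F (e i) (e j) (M i j) := by
  rw [← e.sum_comp]
  refine Finset.sum_congr rfl fun i _ => ?_
  rw [← e.sum_comp]
  refine Finset.sum_congr rfl fun j _ => ?_
  simp

/-- **Frobenius sums are invariant**: `Σ_{i,j} |(reindex e e M) i j|² = Σ_{i,j} |M i j|²`. -/
theorem frobeniusSq_reindex [Fintype β] [Fintype γ] (e : β ≃ γ) (M : Matrix β β ℂ) :
    ∑ i, ∑ j, ‖Matrix.reindex e e M i j‖ ^ 2 = ∑ i, ∑ j, ‖M i j‖ ^ 2 :=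
  sum_sum_reindex_apply e M fun _ _ z => ‖z‖ ^ 2

/-- The rank is invariant under re-indexing (Mathlib's `Matrix.rank_reindex`, recorded in the square shape used below). -/
theorem rank_reindex [Fintype β] [Fintype γ] (e : β ≃ γ) (M : Matrix β β ℂ) : (Matrix.reindex e e M).rank = M.rank :=
  Matrix.rank_reindex e e M

/-- `Fintype.card β = n` whenever `β ≃ Fin n` (the block size as a natural number). -/
theorem card_eq_of_equiv_fin [Fintype β] {n : ℕ} (e : β ≃ Fin n) : Fintype.card β = n := by
  rw [Fintype.card_congr e, Fintype.card_fin]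

end Algebra

section Unitary

variable {β γ : Type*} [Fintype β] [DecidableEq β] [Fintype γ] [DecidableEq γ]

/-! ### §1 Re-indexing as a ⋆-isomorphism of matrix algebras and of unitary groups -/

/-- Re-indexing rows and columns along `e : β ≃ γ` is a multiplicative ⋆-equivalence `Matrix β β ℂ ≃⋆* Matrix γ γ ℂ`. -/
def reindexStarMulEquiv (e : β ≃ γ) : Matrix β β ℂ ≃⋆* Matrix γ γ ℂ :=
  { (Matrix.reindexRingEquiv ℂ e).toMulEquiv with
    map_star' := fun M => by
      change Matrix.reindex e e (Mᴴ) = (Matrix.reindex e e M)ᴴ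
      rw [Matrix.conjTranspose_reindex] }

omit [DecidableEq β] [DecidableEq γ] in
/-- `reindexStarMulEquiv e M = reindex e e M`. -/
@[simp] theorem reindexStarMulEquiv_apply (e : β ≃ γ) (M : Matrix β β ℂ) :
    reindexStarMulEquiv e M = Matrix.reindex e e M := rfl

/-- **Re-indexing of unitary groups** `U(β) ≃⋆* U(γ)` along `e : β ≃ γ`. -/
def reindexUnitary (e : β ≃ γ) : Matrix.unitaryGroup β ℂ ≃⋆* Matrix.unitaryGroup γ ℂ :=
  Unitary.mapEquiv (reindexStarMulEquiv e)

/-- The matrix of `reindexUnitary e U` is `reindex e e U`. -/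
@[simp] theorem coe_reindexUnitary (e : β ≃ γ) (U : Matrix.unitaryGroup β ℂ) :
    ((reindexUnitary e U : Matrix.unitaryGroup γ ℂ) : Matrix γ γ ℂ) = Matrix.reindex e e (U : Matrix β β ℂ) := rfl

/-- The matrix of `(reindexUnitary e).symm V` is `reindex e.symm e.symm V`. -/
@[simp] theorem coe_reindexUnitary_symm (e : β ≃ γ) (V : Matrix.unitaryGroup γ ℂ) :
    (((reindexUnitary e).symm V : Matrix.unitaryGroup β ℂ) : Matrix β β ℂ) =
      Matrix.reindex e.symm e.symm (V : Matrix γ γ ℂ) := rfl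

/-- `reindexUnitary e` is continuous. -/
theorem continuous_reindexUnitary (e : β ≃ γ) : Continuous (reindexUnitary e) := by
  refine continuous_induced_rng.2 ?_
  change Continuous fun U : Matrix.unitaryGroup β ℂ => Matrix.reindex e e (U : Matrix β β ℂ)
  exact continuous_subtype_val.matrix_submatrix _ _

/-- `(reindexUnitary e).symm` is continuous. -/
theorem continuous_reindexUnitary_symm (e : β ≃ γ) : Continuous (reindexUnitary e).symm := by
  refine continuous_induced_rng.2 ?_
  change Continuous fun V : Matrix.unitaryGroup γ ℂ => Matrix.reindex e.symm e.symm (V : Matrix γ γ ℂ)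
  exact continuous_subtype_val.matrix_submatrix _ _

/-- `reindexUnitary e` is measurable (Borel structures). -/
theorem measurable_reindexUnitary (e : β ≃ γ) : Measurable (reindexUnitary e) :=
  (continuous_reindexUnitary e).measurable

/-- `(reindexUnitary e).symm` is measurable. -/
theorem measurable_reindexUnitary_symm (e : β ≃ γ) : Measurable (reindexUnitary e).symm :=
  (continuous_reindexUnitary_symm e).measurable

/-- `reindexUnitary e` as a measurable equivalence `U(β) ≃ᵐ U(γ)`. -/
def reindexUnitaryMeasurableEquiv (e : β ≃ γ) : Matrix.unitaryGroup β ℂ ≃ᵐ Matrix.unitaryGroup γ ℂ where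
  toEquiv := (reindexUnitary e).toEquiv
  measurable_toFun := measurable_reindexUnitary e
  measurable_invFun := measurable_reindexUnitary_symm e

/-- The measurable equivalence is `reindexUnitary e` as a function. -/
@[simp] theorem coe_reindexUnitaryMeasurableEquiv (e : β ≃ γ) :
    ⇑(reindexUnitaryMeasurableEquiv e) = ⇑(reindexUnitary e) := rfl

/-! ### §2 Haar probability is transported to Haar probability -/

/-- Matrices over a finite index type form a second-countable space (recorded as a theorem, used via `haveI`). -/
theorem secondCountableTopology_matrix (n : Type*) [Fintype n] : SecondCountableTopology (Matrix n n ℂ) :=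
  inferInstanceAs (SecondCountableTopology (n → n → ℂ))

/-- `U(β)` is second countable for every finite `β` (used via `haveI`). -/
theorem secondCountableTopology_unitaryGroup (n : Type*) [Fintype n] [DecidableEq n] :
    SecondCountableTopology (Matrix.unitaryGroup n ℂ) := by
  haveI := secondCountableTopology_matrix n
  exact TopologicalSpace.Subtype.secondCountableTopology _

/-- **Uniqueness of the normalised Haar measure**: on a compact second-countable group every left-invariant probability measure
is `haarProbability` (Mathlib's `haarMeasure_unique` with `K₀ = ⊤`). [folklore] -/
theorem eq_haarProbability_of_isMulLeftInvariant {K : Type*} [Group K] [TopologicalSpace K] [IsTopologicalGroup K]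
    [CompactSpace K] [SecondCountableTopology K] [MeasurableSpace K] [BorelSpace K] (μ : Measure K) [IsProbabilityMeasure μ]
    [μ.IsMulLeftInvariant] : μ = haarProbability K := by
  have hne : Nonempty K := ⟨1⟩
  have hμ := Measure.haarMeasure_unique μ (⊤ : TopologicalSpace.PositiveCompacts K)
  rw [TopologicalSpace.PositiveCompacts.coe_top, measure_univ, one_smul] at hμ
  exact hμ

/-- **Haar transport**: the push-forward of `haarProbability U(β)` under re-indexing is `haarProbability U(γ)`. -/
theorem map_haarProbability_reindexUnitary (e : β ≃ γ) :
    (haarProbability (Matrix.unitaryGroup β ℂ)).map (reindexUnitary e) = haarProbability (Matrix.unitaryGroup γ ℂ) := by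
  haveI := secondCountableTopology_unitaryGroup γ
  haveI : IsProbabilityMeasure ((haarProbability (Matrix.unitaryGroup β ℂ)).map (reindexUnitary e)) :=
    Measure.isProbabilityMeasure_map (measurable_reindexUnitary e).aemeasurable
  haveI : ((haarProbability (Matrix.unitaryGroup β ℂ)).map (reindexUnitary e)).IsMulLeftInvariant := by
    have h := MeasureTheory.isMulLeftInvariant_map (μ := haarProbability (Matrix.unitaryGroup β ℂ))
      (reindexUnitary e).toMulEquiv.toMulHom (measurable_reindexUnitary e) (reindexUnitary e).surjective
    exact h
  exact eq_haarProbability_of_isMulLeftInvariant _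

/-- Re-indexing is measure preserving `Haar_{U(β)} → Haar_{U(γ)}`. -/
theorem measurePreserving_reindexUnitary (e : β ≃ γ) :
    MeasurePreserving (reindexUnitary e) (haarProbability (Matrix.unitaryGroup β ℂ))
      (haarProbability (Matrix.unitaryGroup γ ℂ)) :=
  ⟨measurable_reindexUnitary e, map_haarProbability_reindexUnitary e⟩

/-- The same, for the measurable equivalence. -/
theorem measurePreserving_reindexUnitaryMeasurableEquiv (e : β ≃ γ) :
    MeasurePreserving (reindexUnitaryMeasurableEquiv e) (haarProbability (Matrix.unitaryGroup β ℂ))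
      (haarProbability (Matrix.unitaryGroup γ ℂ)) :=
  measurePreserving_reindexUnitary e

/-- **One factor, arbitrary event**: `Haar_{U(β)}((reindexUnitary e)⁻¹' S) = Haar_{U(γ)}(S)` for EVERY set `S` (no measurability
needed: `reindexUnitary e` is a measurable equivalence). -/
theorem haarProbability_preimage_reindexUnitary (e : β ≃ γ) (S : Set (Matrix.unitaryGroup γ ℂ)) :
    haarProbability (Matrix.unitaryGroup β ℂ) (reindexUnitary e ⁻¹' S) = haarProbability (Matrix.unitaryGroup γ ℂ) S :=
  (measurePreserving_reindexUnitaryMeasurableEquiv e).measure_preimage_equiv S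

/-- **One factor, event given by a matrix predicate**: `Haar_{U(β)}{W | Q (reindex e e W)} = Haar_{U(γ)}{V | Q V}`. -/
theorem haarProbability_setOf_reindex (e : β ≃ γ) (Q : Matrix γ γ ℂ → Prop) :
    haarProbability (Matrix.unitaryGroup β ℂ) {W | Q (Matrix.reindex e e (W : Matrix β β ℂ))} =
      haarProbability (Matrix.unitaryGroup γ ℂ) {V | Q (V : Matrix γ γ ℂ)} :=
  haarProbability_preimage_reindexUnitary e {V | Q (V : Matrix γ γ ℂ)}

/-! ### §3 Haar pairs -/

/-- Re-indexing both factors is measure preserving `Haar_{U(β)}² → Haar_{U(γ)}²`. -/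
theorem measurePreserving_reindexUnitary_prod (e : β ≃ γ) :
    MeasurePreserving (Prod.map (reindexUnitary e) (reindexUnitary e))
      ((haarProbability (Matrix.unitaryGroup β ℂ)).prod (haarProbability (Matrix.unitaryGroup β ℂ)))
      ((haarProbability (Matrix.unitaryGroup γ ℂ)).prod (haarProbability (Matrix.unitaryGroup γ ℂ))) :=
  (measurePreserving_reindexUnitary e).prod (measurePreserving_reindexUnitary e)

/-- **Haar pairs, arbitrary event**: `Haar_{U(β)}²((ρ × ρ)⁻¹' S) = Haar_{U(γ)}²(S)` for every set `S`, `ρ = reindexUnitary e`. -/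
theorem haarPair_preimage_reindexUnitary (e : β ≃ γ) (S : Set (Matrix.unitaryGroup γ ℂ × Matrix.unitaryGroup γ ℂ)) :
    (haarProbability (Matrix.unitaryGroup β ℂ)).prod (haarProbability (Matrix.unitaryGroup β ℂ))
        (Prod.map (reindexUnitary e) (reindexUnitary e) ⁻¹' S) =
      (haarProbability (Matrix.unitaryGroup γ ℂ)).prod (haarProbability (Matrix.unitaryGroup γ ℂ)) S := by
  have h : MeasurePreserving
      (MeasurableEquiv.prodCongr (reindexUnitaryMeasurableEquiv e) (reindexUnitaryMeasurableEquiv e))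
      ((haarProbability (Matrix.unitaryGroup β ℂ)).prod (haarProbability (Matrix.unitaryGroup β ℂ)))
      ((haarProbability (Matrix.unitaryGroup γ ℂ)).prod (haarProbability (Matrix.unitaryGroup γ ℂ))) :=
    measurePreserving_reindexUnitary_prod e
  exact h.measure_preimage_equiv S

/-- **Haar pairs, event given by a matrix predicate**:
`Haar_{U(β)}²{P | Q (reindex P.1) (reindex P.2)} = Haar_{U(γ)}²{P | Q P.1 P.2}`. -/
theorem haarPair_setOf_reindex (e : β ≃ γ) (Q : Matrix γ γ ℂ → Matrix γ γ ℂ → Prop) :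
    (haarProbability (Matrix.unitaryGroup β ℂ)).prod (haarProbability (Matrix.unitaryGroup β ℂ))
        {P | Q (Matrix.reindex e e (P.1 : Matrix β β ℂ)) (Matrix.reindex e e (P.2 : Matrix β β ℂ))} =
      (haarProbability (Matrix.unitaryGroup γ ℂ)).prod (haarProbability (Matrix.unitaryGroup γ ℂ))
        {P | Q (P.1 : Matrix γ γ ℂ) (P.2 : Matrix γ γ ℂ)} :=
  haarPair_preimage_reindexUnitary e {P | Q (P.1 : Matrix γ γ ℂ) (P.2 : Matrix γ γ ℂ)}

/-! ### §4 Haar powers (`Fin d`-tuples of links) -/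

/-- Re-indexing every link is measure preserving `⊗_{μ<d} Haar_{U(β)} → ⊗_{μ<d} Haar_{U(γ)}`. -/
theorem measurePreserving_reindexUnitary_pi (e : β ≃ γ) (d : ℕ) :
    MeasurePreserving (fun (W : Fin d → Matrix.unitaryGroup β ℂ) (μ : Fin d) => reindexUnitary e (W μ))
      (Measure.pi fun _ : Fin d => haarProbability (Matrix.unitaryGroup β ℂ))
      (Measure.pi fun _ : Fin d => haarProbability (Matrix.unitaryGroup γ ℂ)) :=
  measurePreserving_pi _ _ fun _ => measurePreserving_reindexUnitary e

/-- **Haar powers, arbitrary event**: `(⊗ Haar_{U(β)})((W ↦ ρ ∘ W)⁻¹' S) = (⊗ Haar_{U(γ)})(S)` for every set `S`. -/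
theorem haarPi_preimage_reindexUnitary (e : β ≃ γ) (d : ℕ) (S : Set (Fin d → Matrix.unitaryGroup γ ℂ)) :
    (Measure.pi fun _ : Fin d => haarProbability (Matrix.unitaryGroup β ℂ))
        ((fun (W : Fin d → Matrix.unitaryGroup β ℂ) (μ : Fin d) => reindexUnitary e (W μ)) ⁻¹' S) =
      (Measure.pi fun _ : Fin d => haarProbability (Matrix.unitaryGroup γ ℂ)) S := by
  have h : MeasurePreserving (MeasurableEquiv.piCongrRight fun _ : Fin d => reindexUnitaryMeasurableEquiv e)
      (Measure.pi fun _ : Fin d => haarProbability (Matrix.unitaryGroup β ℂ))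
      (Measure.pi fun _ : Fin d => haarProbability (Matrix.unitaryGroup γ ℂ)) :=
    measurePreserving_reindexUnitary_pi e d
  exact h.measure_preimage_equiv S

/-- **Into the Eguchi–Kawai a-priori measure**: for `e : β ≃ Fin n`, re-indexing every link is measure preserving
`⊗_{μ<d} Haar_{U(β)} → ekHaar d n`. -/
theorem measurePreserving_reindexUnitary_pi_ekHaar {n : ℕ} (e : β ≃ Fin n) (d : ℕ) :
    MeasurePreserving (fun (W : Fin d → Matrix.unitaryGroup β ℂ) (μ : Fin d) => reindexUnitary e (W μ))
      (Measure.pi fun _ : Fin d => haarProbability (Matrix.unitaryGroup β ℂ)) (ekHaar d n) :=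
  measurePreserving_reindexUnitary_pi e d

/-- **Haar powers into `ekHaar`, arbitrary event**: `(⊗_{μ<d} Haar_{U(β)}){W | (μ ↦ ρ (W μ)) ∈ S} = ekHaar d n S` for every set
`S` of Eguchi–Kawai configurations (`e : β ≃ Fin n`, `ρ = reindexUnitary e`). -/
theorem haarPi_preimage_reindexUnitary_eq_ekHaar {n : ℕ} (e : β ≃ Fin n) (d : ℕ) (S : Set (EKConfig d n)) :
    (Measure.pi fun _ : Fin d => haarProbability (Matrix.unitaryGroup β ℂ))
        {W : Fin d → Matrix.unitaryGroup β ℂ | (fun μ : Fin d => reindexUnitary e (W μ)) ∈ S} = ekHaar d n S :=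
  haarPi_preimage_reindexUnitary e d S

/-- **Haar powers into `ekHaar`, event given by a predicate on link matrices**:
`(⊗ Haar_{U(β)}){W | Q (μ ↦ reindex e e (W μ))} = ekHaar d n {U | Q (μ ↦ U μ)}`. -/
theorem haarPi_setOf_reindex_eq_ekHaar {n : ℕ} (e : β ≃ Fin n) (d : ℕ) (Q : (Fin d → Matrix (Fin n) (Fin n) ℂ) → Prop) :
    (Measure.pi fun _ : Fin d => haarProbability (Matrix.unitaryGroup β ℂ))
        {W : Fin d → Matrix.unitaryGroup β ℂ | Q fun μ => Matrix.reindex e e (W μ : Matrix β β ℂ)} =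
      ekHaar d n {U : EKConfig d n | Q fun μ => (U μ : Matrix (Fin n) (Fin n) ℂ)} :=
  haarPi_preimage_reindexUnitary e d {U : EKConfig d n | Q fun μ => (U μ : Matrix (Fin n) (Fin n) ℂ)}

/-! ### §5 Worked instances: the rank-robust commutator events -/

omit [DecidableEq β] [DecidableEq γ] in
/-- The rank-robust commutator predicate is transported: for matrices `A, B` over `β`,
`(∃ L over β, rank L ≤ r ∧ ‖AB − BA − L‖_F² ≤ σ) ↔ (∃ L over γ, rank L ≤ r ∧ ‖A'B' − B'A' − L‖_F² ≤ σ)` with `A' = reindex e e A`,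
`B' = reindex e e B`. -/
theorem exists_rankRobustCommutator_reindex_iff (e : β ≃ γ) (A B : Matrix β β ℂ) (r : ℕ) (σ : ℝ) :
    (∃ L : Matrix γ γ ℂ, L.rank ≤ r ∧
        ∑ i, ∑ j, ‖(Matrix.reindex e e A * Matrix.reindex e e B - Matrix.reindex e e B * Matrix.reindex e e A - L) i j‖ ^ 2 ≤ σ) ↔
      (∃ L : Matrix β β ℂ, L.rank ≤ r ∧ ∑ i, ∑ j, ‖(A * B - B * A - L) i j‖ ^ 2 ≤ σ) := by
  constructor
  · rintro ⟨L, hr, hL⟩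
    refine ⟨Matrix.reindex e.symm e.symm L, ?_, ?_⟩
    · rw [Matrix.rank_reindex]; exact hr
    · have h : Matrix.reindex e e A * Matrix.reindex e e B - Matrix.reindex e e B * Matrix.reindex e e A - L =
          Matrix.reindex e e (A * B - B * A - Matrix.reindex e.symm e.symm L) := by
        rw [reindex_sub, reindex_sub, reindex_mul, reindex_mul, reindex_reindex_symm]
      rw [h, frobeniusSq_reindex] at hL
      exact hL
  · rintro ⟨L, hr, hL⟩
    refine ⟨Matrix.reindex e e L, ?_, ?_⟩
    · rw [Matrix.rank_reindex]; exact hr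
    · have h : Matrix.reindex e e A * Matrix.reindex e e B - Matrix.reindex e e B * Matrix.reindex e e A - Matrix.reindex e e L =
          Matrix.reindex e e (A * B - B * A - L) := by
        rw [reindex_sub, reindex_sub, reindex_mul, reindex_mul]
      rw [h, frobeniusSq_reindex]
      exact hL

/-- **The S9 slot `h_Ψ` transported**: the Haar-pair measure of the rank-robust commutator event
`{(P₁,P₂) | ∃ L, rank L ≤ r ∧ ‖P₁P₂ − P₂P₁ − L‖_F² ≤ σ}` is the SAME over `U(β)` and over `U(γ)` whenever `β ≃ γ` — so a bound
proved for `UN n` (`Ψ_rob`) applies verbatim to every block group `U({i // ℓ i = c})` of size `n`. -/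
theorem haarPair_rankRobustCommutator_reindex (e : β ≃ γ) (r : ℕ) (σ : ℝ) :
    (haarProbability (Matrix.unitaryGroup β ℂ)).prod (haarProbability (Matrix.unitaryGroup β ℂ))
        {P | ∃ L : Matrix β β ℂ, L.rank ≤ r ∧
          ∑ i, ∑ j, ‖((P.1 : Matrix β β ℂ) * (P.2 : Matrix β β ℂ) - (P.2 : Matrix β β ℂ) * (P.1 : Matrix β β ℂ) - L) i j‖ ^ 2 ≤ σ} =
      (haarProbability (Matrix.unitaryGroup γ ℂ)).prod (haarProbability (Matrix.unitaryGroup γ ℂ))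
        {P | ∃ L : Matrix γ γ ℂ, L.rank ≤ r ∧
          ∑ i, ∑ j, ‖((P.1 : Matrix γ γ ℂ) * (P.2 : Matrix γ γ ℂ) - (P.2 : Matrix γ γ ℂ) * (P.1 : Matrix γ γ ℂ) - L) i j‖ ^ 2 ≤ σ} := by
  rw [← haarPair_setOf_reindex e (fun A B => ∃ L : Matrix γ γ ℂ, L.rank ≤ r ∧
    ∑ i, ∑ j, ‖(A * B - B * A - L) i j‖ ^ 2 ≤ σ)]
  congr 1
  ext P
  exact (exists_rankRobustCommutator_reindex_iff e _ _ r σ).symm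

omit [DecidableEq β] [DecidableEq γ] in
/-- The rank-robust one-link predicate is transported: for matrices `D, W` over `β`,
`(∃ R over γ, rank R ≤ r ∧ ‖D'W' − W'D' − R‖_F² ≤ s) ↔ (∃ R over β, rank R ≤ r ∧ ‖DW − WD − R‖_F² ≤ s)`. -/
theorem exists_rankRobustLink_reindex_iff (e : β ≃ γ) (D W : Matrix β β ℂ) (r : ℕ) (s : ℝ) :
    (∃ R : Matrix γ γ ℂ, R.rank ≤ r ∧
        ∑ i, ∑ j, ‖(Matrix.reindex e e D * Matrix.reindex e e W - Matrix.reindex e e W * Matrix.reindex e e D - R) i j‖ ^ 2 ≤ s) ↔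
      (∃ R : Matrix β β ℂ, R.rank ≤ r ∧ ∑ i, ∑ j, ‖(D * W - W * D - R) i j‖ ^ 2 ≤ s) :=
  exists_rankRobustCommutator_reindex_iff e D W r s

/-- **The rank-robust one-link rigidity event transported** (shape of `E_rob`): for a FIXED matrix `D` over `β`,
`Haar_{U(β)}{W | ∃ R, rank R ≤ r ∧ ‖DW − WD − R‖_F² ≤ s} = Haar_{U(γ)}{V | ∃ R, rank R ≤ r ∧ ‖D'V − VD' − R‖_F² ≤ s}`,
`D' = reindex e e D` (a diagonal `D = diagonal d` becomes `diagonal (d ∘ e.symm)`, `reindex_diagonal`). -/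
theorem haarProbability_rankRobustLink_reindex (e : β ≃ γ) (D : Matrix β β ℂ) (r : ℕ) (s : ℝ) :
    haarProbability (Matrix.unitaryGroup β ℂ)
        {W | ∃ R : Matrix β β ℂ, R.rank ≤ r ∧
          ∑ i, ∑ j, ‖(D * (W : Matrix β β ℂ) - (W : Matrix β β ℂ) * D - R) i j‖ ^ 2 ≤ s} =
      haarProbability (Matrix.unitaryGroup γ ℂ)
        {V | ∃ R : Matrix γ γ ℂ, R.rank ≤ r ∧
          ∑ i, ∑ j, ‖(Matrix.reindex e e D * (V : Matrix γ γ ℂ) - (V : Matrix γ γ ℂ) * Matrix.reindex e e D - R) i j‖ ^ 2 ≤ s} := by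
  rw [← haarProbability_setOf_reindex e (fun V => ∃ R : Matrix γ γ ℂ, R.rank ≤ r ∧
    ∑ i, ∑ j, ‖(Matrix.reindex e e D * V - V * Matrix.reindex e e D - R) i j‖ ^ 2 ≤ s)]
  congr 1
  ext W
  exact (exists_rankRobustLink_reindex_iff e D _ r s).symm

/-- **The plain commutator / weighted-entry events transported** (shapes of `Ψ` and `E`): with no rank slack the same holds for
`{‖P₁P₂ − P₂P₁‖_F² ≤ σ}` — the special case `r = 0`-free form, stated directly. -/
theorem haarPair_commutator_reindex (e : β ≃ γ) (σ : ℝ) :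
    (haarProbability (Matrix.unitaryGroup β ℂ)).prod (haarProbability (Matrix.unitaryGroup β ℂ))
        {P | ∑ i, ∑ j, ‖((P.1 : Matrix β β ℂ) * (P.2 : Matrix β β ℂ) - (P.2 : Matrix β β ℂ) * (P.1 : Matrix β β ℂ)) i j‖ ^ 2 ≤ σ} =
      (haarProbability (Matrix.unitaryGroup γ ℂ)).prod (haarProbability (Matrix.unitaryGroup γ ℂ))
        {P | ∑ i, ∑ j, ‖((P.1 : Matrix γ γ ℂ) * (P.2 : Matrix γ γ ℂ) - (P.2 : Matrix γ γ ℂ) * (P.1 : Matrix γ γ ℂ)) i j‖ ^ 2 ≤ σ} := by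
  rw [← haarPair_setOf_reindex e (fun A B => ∑ i, ∑ j, ‖(A * B - B * A) i j‖ ^ 2 ≤ σ)]
  congr 1
  ext P
  simp only [Set.mem_setOf_eq]
  rw [← reindex_mul, ← reindex_mul, ← reindex_sub, frobeniusSq_reindex]

/-- Weighted entrywise event for a fixed left factor `A` (shape of entrywise rigidity of `A·W`):
`Haar_{U(β)}{W | Σ_{jk} w j k |(A W)_{jk}|² ≤ s} = Haar_{U(γ)}{V | Σ_{jk} w (e⁻¹ j) (e⁻¹ k) |((reindex A) V)_{jk}|² ≤ s}`. -/
theorem haarProbability_weightedEntry_reindex (e : β ≃ γ) (A : Matrix β β ℂ) (w : β → β → ℝ) (s : ℝ) :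
    haarProbability (Matrix.unitaryGroup β ℂ) {W | ∑ j, ∑ k, w j k * ‖(A * (W : Matrix β β ℂ)) j k‖ ^ 2 ≤ s} =
      haarProbability (Matrix.unitaryGroup γ ℂ)
        {V | ∑ j, ∑ k, w (e.symm j) (e.symm k) * ‖(Matrix.reindex e e A * (V : Matrix γ γ ℂ)) j k‖ ^ 2 ≤ s} := by
  rw [← haarProbability_setOf_reindex e (fun V => ∑ j, ∑ k, w (e.symm j) (e.symm k) * ‖(Matrix.reindex e e A * V) j k‖ ^ 2 ≤ s)]
  congr 1
  ext W
  simp only [Set.mem_setOf_eq]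
  rw [← reindex_mul, sum_sum_reindex_apply e (A * (W : Matrix β β ℂ)) (fun j k z => w (e.symm j) (e.symm k) * ‖z‖ ^ 2)]
  simp

end Unitary

end HaarReindex

end Summit.QuantumFields.YangMills.Theorems.EguchiKawaiDirectionLadder

end
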